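import Literature.NumberTheory.EllipticCurves.GreenbergSelmer
import Literature.NumberTheory.EllipticCurves.IwasawaSelmerDualProofs
import HarnessLib

/-!
# The Pontryagin dual of a Greenberg STRICT Selmer group `Sel^{str}_L(K_∞, E[p^∞])` EXISTS as a
# `Λ = ℤ_p⟦T⟧`-module (any number field `K`, any prime `p`, any Greenberg local data `L` above `p`)

Sibling proof file of `Literature.NumberTheory.EllipticCurves.GreenbergSelmer` (the Greenberg/strict Selmer
groups `GreenbergSelmer.strictSelmerInfty κ M L` of a discrete `Γ_K`-module `M` over the top `K_∞` of a
`ℤ_p`-extension `κ`, for local data `L : GreenbergSelmer.Data K M p` — a choice of `M⁺_v ≤ M` at every `v ∣ p`;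
strict at `v` = `M⁺_v = ⊥`, relaxed = `M⁺_v = ⊤`, ordinary = the `p`-adic filtration), written for the
`p`-primary torsion `M = E[p^∞] = W.geomPrimaryTorsion p` of an elliptic curve `W/K`.

WORD FOR WORD the tree's constructions `WeierstrassCurve.selmerDualData` (file `IwasawaSelmerDualProofs`, the
usual Selmer group) and `WeierstrassCurve.fineSelmerDualData` (file `KatoFineSelmerDualProofs`, the fine Selmer
group = the all-strict data), with `selmerInfty ↦ GreenbergSelmer.strictSelmerInfty κ (E[p^∞]) L`:

* §1 `WeierstrassCurve.GreenbergStrictSelmerDualData W κ γ L` — the HYPOTHESIS STRUCTURE (exactly the pattern of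
  `WeierstrassCurve.SelmerDualData` / `FineSelmerDualData`): an abstract `Λ`-module `X` with a bijective additive
  `toDual : X → Hom(Sel^{str}_L(K_∞, E[p^∞]), ℚ/ℤ)` under which `T` acts as `conj_γ − 1`
  (`GreenbergSelmer.conjH1_mem_strictSelmerGroupOver`) and constants act through `ℤ/p^k` on `p^k`-torsion classes.
  It is VERBATIM the structure `GrDualData` of the registered skeleton
  `Summits/…/Cruxes/OrdLambdaHalfAtTwo/Lines/kato_determinant_greenberg_two.lean` (line `kato-determinant-greenberg-two`
  of crux `OrdLambdaHalfAtTwo`, item stmt-BirchSwinnertonDyer-19556) for the curve `W.baseChange K` and `p = 2`,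
  now available Literature-side to every Greenberg-structure line (cyclotomic line over an auxiliary imaginary
  quadratic field, BDP-type «Selmer (∅, 0)», two-variable descents).
* §2 `conjGreenbergStrictSelmerInfty`, local nilpotence of `conj_γ − 1` (from the tree statements (P)
  `exists_pow_smul_subgroupH1_ker_eq_zero` and (A2) `exists_conjH1_pow_prime_pow_eq` about ALL of
  `H¹(K_∞, E[p^∞])`), and the CONSTRUCTION `greenbergStrictSelmerDualData` (`X = Hom(Sel, ℚ/ℤ)`, `toDual = id`,
  module structure `IwasawaDual.IsLocNil.module`) with `nonempty_…` / `exists_…` corollaries — the NON-VACUITY of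
  every statement `∀ D : GreenbergStrictSelmerDualData …, …` (e.g. the skeleton's `stub_greenbergSupplyAtTwo` asks,
  among other things, for such data to exist for the Greenberg (strict at `w`, relaxed at `w̄`) and the fine data).

HONEST FRAMING. Pure existence of the dual as a `Λ`-module; NOTHING about its size (cotorsion, `μ`, `λ`) is
claimed — those are the arithmetic content of the lines that consume it.  BSD is not proved by any of this.

References: R. Greenberg, *Iwasawa theory for `p`-adic representations*, Adv. Stud. Pure Math. 17 (1989) §1
p. 98 [Greenberg1989]; R. Greenberg, LNM 1716 (1999) §1 (PDF p. 60) [GreenbergLNM1716]; B. Mazur, Invent. Math.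
18 (1972) §6 [Mazur1972]; L. Washington, *Introduction to Cyclotomic Fields* §13.2 [Washington1997].
-/

noncomputable section

open scoped Classical

open Literature.NumberTheory.EllipticCurves Literature.NumberTheory.EllipticCurves.IwasawaAlgebra
  Literature.NumberTheory.EllipticCurves.IwasawaDual
  Literature.NumberTheory.EllipticCurves.ZpExtension

universe u

namespace WeierstrassCurve

variable {K : Type u} [Field K] [NumberField K] (W : WeierstrassCurve K) {p : ℕ} [Fact p.Prime]
  (κ : ZpExtension K p) (γ : Field.absoluteGaloisGroup K)
  (L : GreenbergSelmer.Data K (↥(W.geomPrimaryTorsion p)) p)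

/-! ## §1 The hypothesis structure -/

/-- **Pontryagin-dual data for a Greenberg strict Selmer group `Sel^{str}_L(K_∞, E[p^∞])`** (hypothesis
structure, the pattern of `WeierstrassCurve.SelmerDualData` / `FineSelmerDualData`): the Iwasawa module
`X = Hom(Sel^{str}_L(K_∞, E[p^∞]), ℚ_p/ℤ_p)` as an abstract `Λ = ℤ_p⟦T⟧`-module `X` with a bijective additive
`toDual : X → Hom(Sel, ℚ/ℤ)`, `T` acting as `conj_γ − 1` (`toDual_T_smul`; the strict Selmer group is
`conj`-stable by `GreenbergSelmer.conjH1_mem_strictSelmerGroupOver`) and constants `c ∈ ℤ_p` acting on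
`p^k`-torsion classes through `ℤ_p → ℤ/p^k` (`toDual_C_smul`).  Greenberg 1989 §1 p. 98 ("we regard the
Pontryagin dual of the Selmer group over `K_∞` as a `Λ`-module"); Greenberg 1999 §1.
[cite: Greenberg1989, §1 p. 98] [cite: GreenbergLNM1716, §1 (after Conj. 1.3)] [cite: Mazur1972, §6] -/
structure GreenbergStrictSelmerDualData where
  /-- The underlying type of the Iwasawa module `X = Hom(Sel^{str}_L(K_∞, E[p^∞]), ℚ/ℤ)`. -/
  X : Type u
  /-- `X` is an abelian group. -/
  [addCommGroup : AddCommGroup X]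
  /-- `X` is a `Λ = ℤ_p⟦T⟧`-module. -/
  [module : Module (IwasawaAlgebra p) X]
  /-- The identification of `X` with the character group `Hom(Sel^{str}_L(K_∞), ℚ/ℤ)`. -/
  toDual : X →+ (GreenbergSelmer.strictSelmerInfty κ (↥(W.geomPrimaryTorsion p)) L →+ AddCircle (1 : ℚ))
  /-- `toDual` is a group isomorphism. -/
  bijective : Function.Bijective toDual
  /-- `T` acts as `γ - 1`: `(T·x)(s) = x(conj_γ s) - x(s)`. -/
  toDual_T_smul : ∀ (x : X) (s : GreenbergSelmer.strictSelmerInfty κ (↥(W.geomPrimaryTorsion p)) L),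
    toDual ((PowerSeries.X : IwasawaAlgebra p) • x) s =
      toDual x ⟨W.conjH1 p κ.kerSubgroup γ s, GreenbergSelmer.conjH1_mem_strictSelmerGroupOver γ s.2⟩ -
        toDual x s
  /-- Constants `c ∈ ℤ_p` act on `p^k`-torsion classes through `ℤ_p → ℤ/p^k`. -/
  toDual_C_smul : ∀ (c : ℤ_[p]) (x : X)
    (s : GreenbergSelmer.strictSelmerInfty κ (↥(W.geomPrimaryTorsion p)) L) (k : ℕ), (p ^ k) • s = 0 →
    toDual (PowerSeries.C c • x) s = (PadicInt.toZModPow k c).val • toDual x s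

attribute [instance] GreenbergStrictSelmerDualData.addCommGroup GreenbergStrictSelmerDualData.module

/-! ## §2 Construction -/

/-- `conj_γ` restricted to an endomorphism of `Sel^{str}_L(K_∞, E[p^∞])` (it preserves the strict Selmer group:
`GreenbergSelmer.conjH1_mem_strictSelmerGroupOver`). [cite: Greenberg1989, §1 p. 98] -/
def conjGreenbergStrictSelmerInfty :
    AddMonoid.End (GreenbergSelmer.strictSelmerInfty κ (↥(W.geomPrimaryTorsion p)) L) :=
  ((W.conjH1 p κ.kerSubgroup γ).restrict
      (GreenbergSelmer.strictSelmerInfty κ (↥(W.geomPrimaryTorsion p)) L)).codRestrict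
    (GreenbergSelmer.strictSelmerInfty κ (↥(W.geomPrimaryTorsion p)) L)
    fun s ↦ GreenbergSelmer.conjH1_mem_strictSelmerGroupOver γ s.2

/-- Unfolding `conjGreenbergStrictSelmerInfty` (definitional). [cite: Greenberg1989, §1 p. 98] -/
@[simp]
theorem coe_conjGreenbergStrictSelmerInfty_apply
    (s : GreenbergSelmer.strictSelmerInfty κ (↥(W.geomPrimaryTorsion p)) L) :
    ((W.conjGreenbergStrictSelmerInfty κ γ L s :
        GreenbergSelmer.strictSelmerInfty κ (↥(W.geomPrimaryTorsion p)) L) : W.subgroupH1 p κ.kerSubgroup) =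
      W.conjH1 p κ.kerSubgroup γ s :=
  rfl

/-- Powers of the restriction are restrictions of `conj_{γ^m}` (`conjH1_one_holds`, `conjH1_mul_holds`).
[cite: GreenbergLNM1716, §1 (after Conj. 1.3)] -/
theorem coe_conjGreenbergStrictSelmerInfty_pow_apply (m : ℕ)
    (s : GreenbergSelmer.strictSelmerInfty κ (↥(W.geomPrimaryTorsion p)) L) :
    ((((W.conjGreenbergStrictSelmerInfty κ γ L) ^ m) s :
        GreenbergSelmer.strictSelmerInfty κ (↥(W.geomPrimaryTorsion p)) L) : W.subgroupH1 p κ.kerSubgroup) =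
      W.conjH1 p κ.kerSubgroup (γ ^ m) s := by
  induction m generalizing s with
  | zero => rw [pow_zero, pow_zero, AddMonoid.End.one_apply, W.conjH1_one_holds p κ.kerSubgroup,
      AddMonoidHom.id_apply]
  | succ m ih =>
    rw [pow_succ, AddMonoid.End.coe_mul, Function.comp_apply, ih, coe_conjGreenbergStrictSelmerInfty_apply,
      pow_succ, W.conjH1_mul_holds p κ.kerSubgroup, AddMonoidHom.comp_apply]

variable {γ} in
/-- **`Sel^{str}_L(K_∞, E[p^∞])` is `p`-primary and `T = γ − 1` is locally nilpotent on it** (the hypotheses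
`IwasawaDual.IsLocNil` of the generic `Λ`-action), for `γ` a topological generator: (P)
`exists_pow_smul_subgroupH1_ker_eq_zero` and (A2) `exists_conjH1_pow_prime_pow_eq` (statements about all of
`H¹(K_∞, E[p^∞])`) with `IwasawaDual.pow_mul_prime_pow_apply_eq_zero` — word for word
`isLocNil_conjSelmerInfty_sub_one`. [cite: GreenbergLNM1716, §1 (after Conj. 1.3)] -/
theorem isLocNil_conjGreenbergStrictSelmerInfty_sub_one (hγ : κ.IsTopGenerator γ) :
    IwasawaDual.IsLocNil p (W.conjGreenbergStrictSelmerInfty κ γ L - 1) := by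
  have htor : ∀ s : GreenbergSelmer.strictSelmerInfty κ (↥(W.geomPrimaryTorsion p)) L,
      ∃ k : ℕ, p ^ k • s = 0 := fun s ↦ by
    obtain ⟨k, hk⟩ := W.exists_pow_smul_subgroupH1_ker_eq_zero κ (s : W.subgroupH1 p κ.kerSubgroup)
    exact ⟨k, Subtype.ext (by rw [AddSubgroupClass.coe_nsmul]; exact hk)⟩
  refine ⟨htor, fun s ↦ ?_⟩
  obtain ⟨a, ha⟩ := W.exists_conjH1_pow_prime_pow_eq κ hγ (s : W.subgroupH1 p κ.kerSubgroup)
  obtain ⟨k, hk⟩ := htor s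
  have hφ : ((W.conjGreenbergStrictSelmerInfty κ γ L) ^ p ^ a) s = s :=
    Subtype.ext (by rw [coe_conjGreenbergStrictSelmerInfty_pow_apply]; exact ha)
  exact ⟨k * p ^ a, IwasawaDual.pow_mul_prime_pow_apply_eq_zero (Fact.out : p.Prime) _ a hφ hk⟩

variable {γ} in
/-- **The dual `X = Hom(Sel^{str}_L(K_∞, E[p^∞]), ℚ/ℤ)` with its `Λ`-module structure** (`T = γ − 1`,
constants through `ℤ_p → ℤ/p^k`) packaged as `W.GreenbergStrictSelmerDualData κ γ L`: `X = (Sel →+ AddCircle 1)`,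
`toDual = id`, the module structure `IsLocNil.module`, and the two compatibilities by `smulFun_X_apply`,
`smulFun_C_apply` — word for word the tree's `selmerDualData` / `fineSelmerDualData`.
[cite: Greenberg1989, §1 p. 98] [cite: GreenbergLNM1716, §1 (after Conj. 1.3)] -/
def greenbergStrictSelmerDualData (hγ : κ.IsTopGenerator γ) : W.GreenbergStrictSelmerDualData κ γ L :=
  { X := GreenbergSelmer.strictSelmerInfty κ (↥(W.geomPrimaryTorsion p)) L →+ AddCircle (1 : ℚ)
    module := (W.isLocNil_conjGreenbergStrictSelmerInfty_sub_one κ L hγ).module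
    toDual := AddMonoidHom.id _
    bijective := Function.bijective_id
    toDual_T_smul := fun x s ↦ by
      show (W.isLocNil_conjGreenbergStrictSelmerInfty_sub_one κ L hγ).smulFun PowerSeries.X x s = x _ - x s
      rw [(W.isLocNil_conjGreenbergStrictSelmerInfty_sub_one κ L hγ).smulFun_X_apply,
        IwasawaDual.End_sub_apply, AddMonoid.End.one_apply, map_sub]
      rfl
    toDual_C_smul := fun c x s k hk ↦ by
      show (W.isLocNil_conjGreenbergStrictSelmerInfty_sub_one κ L hγ).smulFun (PowerSeries.C c) x s = _
      exact (W.isLocNil_conjGreenbergStrictSelmerInfty_sub_one κ L hγ).smulFun_C_apply c x hk }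

variable {γ} in
/-- **Existence**: for `γ` a topological generator of `Gal(K_∞/K)` and ANY Greenberg local data `L`, the dual
of `Sel^{str}_L(K_∞, E[p^∞])` carries a `Λ`-module structure with `T = γ − 1`, i.e.
`W.GreenbergStrictSelmerDualData κ γ L` is inhabited. [cite: Greenberg1989, §1 p. 98] [cite: GreenbergLNM1716, §1 (after Conj. 1.3)] -/
theorem nonempty_greenbergStrictSelmerDualData (hγ : κ.IsTopGenerator γ) :
    Nonempty (W.GreenbergStrictSelmerDualData κ γ L) :=
  ⟨W.greenbergStrictSelmerDualData κ L hγ⟩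

/-- **For EVERY `ℤ_p`-extension `κ` and Greenberg data `L` the dual datum exists for some topological
generator `γ`** (one exists since `κ : Γ_K → ℤ_p` is onto `1`). [cite: GreenbergLNM1716, §1 (after Conj. 1.3)] -/
theorem exists_greenbergStrictSelmerDualData :
    ∃ (γ : Field.absoluteGaloisGroup K) (_ : κ.IsTopGenerator γ),
      Nonempty (W.GreenbergStrictSelmerDualData κ γ L) :=
  have ⟨γ, hγ⟩ : ∃ γ : Field.absoluteGaloisGroup K, κ.IsTopGenerator γ :=
    κ.surjective (Multiplicative.ofAdd 1)
  ⟨γ, hγ, W.nonempty_greenbergStrictSelmerDualData κ L hγ⟩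

/-- **The fields of the datum, UNPACKED** (for consumers that axiomatise the dual by their own copy of the
structure, e.g. the skeleton `Lines/kato_determinant_greenberg_two.lean`'s `GrDualData` for `W.baseChange K`,
`p = 2`): there are a `Λ`-module `X` and a bijective additive `toDual : X → Hom(Sel^{str}_L(K_∞, E[p^∞]), ℚ/ℤ)`
with the `T`- and `C`-compatibilities. [cite: Greenberg1989, §1 p. 98] [cite: GreenbergLNM1716, §1 (after Conj. 1.3)] -/
theorem exists_greenbergStrictSelmerDual_fields {γ : Field.absoluteGaloisGroup K} (hγ : κ.IsTopGenerator γ) :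
    ∃ (X : Type u) (_ : AddCommGroup X) (_ : Module (IwasawaAlgebra p) X)
      (toDual : X →+ (GreenbergSelmer.strictSelmerInfty κ (↥(W.geomPrimaryTorsion p)) L →+ AddCircle (1 : ℚ))),
      Function.Bijective toDual ∧
      (∀ (x : X) (s : GreenbergSelmer.strictSelmerInfty κ (↥(W.geomPrimaryTorsion p)) L),
        toDual ((PowerSeries.X : IwasawaAlgebra p) • x) s =
          toDual x ⟨W.conjH1 p κ.kerSubgroup γ s, GreenbergSelmer.conjH1_mem_strictSelmerGroupOver γ s.2⟩ -
            toDual x s) ∧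
      (∀ (c : ℤ_[p]) (x : X) (s : GreenbergSelmer.strictSelmerInfty κ (↥(W.geomPrimaryTorsion p)) L)
        (k : ℕ), (p ^ k) • s = 0 →
        toDual (PowerSeries.C c • x) s = (PadicInt.toZModPow k c).val • toDual x s) :=
  let D := W.greenbergStrictSelmerDualData κ L hγ
  ⟨D.X, D.addCommGroup, D.module, D.toDual, D.bijective, D.toDual_T_smul, D.toDual_C_smul⟩

end WeierstrassCurve

end
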